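import Mathlib.LinearAlgebra.Matrix.NonsingularInverse
import Mathlib.LinearAlgebra.FiniteDimensional.Lemmas
import Mathlib.Algebra.MvPolynomial.Funext
import Mathlib.Logic.Equiv.Fintype
import HarnessLib

/-!
# Landsberg–Ressayre, Thm. 2.8 — steps (B4c), (B6): counting in a good graded pencil

Topic `Literature/Computability/AlgebraicComplexity`.  Fourth file of the bottom-up proof of
`lr_left_equivariant_lower` (LR17 Thm. 2.8; plan in `LandsbergRessayreNormalForm.lean`).  This is
the combinatorial heart of LR17 §6 (last page: the chain `ℍ_1, …, ℍ_k`, the lengths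
`ℓ(χ_{ℍ_{i_s}}) = s` for `s = 1, …, m-1`, and `dim ℍ_{i_s} ≥ C(m, s)` by transitivity of the
permutation group on `s`-subsets), in the elementary reformulation:

**Setting ("good graded pencil").**  A square matrix `A` over a polynomial ring, indexed by `ι`,
whose columns `c` and rows `r` carry subsets `IS c, IT r ⊆ [m]` (the degrees `q + 𝟙_I` of LR's
weight spaces) such that
* (h01) a non-zero entry `A r c` forces `IT r = IS c` (constant entries) or `IT r = IS c ∪ {i}` with
  `i ∉ IS c` (the row-`i` linear entries);
* (hdet) `det A ≠ 0`;
* (h3) multiplicities: `#{r : IT r = I} + [I = ∅] = #{c : IS c = I} + [I = [m]]` (the kernel of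
  `Λ` sits in degree `∅`, its cokernel in degree `[m]`);
* (h4) symmetry: `#{c : IS c = σ(I)} = #{c : IS c = I}` for every permutation `σ` of `[m]`.

**Theorem** `two_pow_sub_one_le_card_of_goodGradedPencil`: then `2^m - 1 ≤ |ι|` (`m ≥ 1`).
Proof: if no column had `|IS c| = s` (`1 ≤ s ≤ m-1`), the columns of level `< s` would be
supported in the rows of level `< s`, of which there is one fewer (h3 at `∅`), forcing `det A = 0`
(`det_eq_zero_of_cols_supported`); so every level occurs, by (h4) every `I` with
`1 ≤ |I| ≤ m - 1` occurs, and with the kernel column this gives `(2^m - 2) + 1` columns.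
[cite: LandsbergRessayre2017, §6]

All declarations of this auxiliary development live in the sub-namespace `Literature.CplxAlg.LR28`.

## References

* J. M. Landsberg, N. Ressayre, *Permanent v. determinant: an exponential lower bound assuming
  symmetry and a potential path towards Valiant's conjecture*, Differential Geom. Appl. 55 (2017)
  146–166, arXiv:1508.05788, §6, proof of Thm. 2.8 (pp. 14–15).
-/

noncomputable section

namespace Literature.Computability.AlgebraicComplexity.LR28

open Finset

/-! ### Columns supported in too few rows force `det = 0` -/

section FewRows

variable {K : Type*} [Field K] {ι : Type*} [Fintype ι] [DecidableEq ι]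

/-- If the columns in `C` of a square matrix have non-zero entries only in the rows in `R`, and
`|R| < |C|`, then `det = 0` (these columns are linearly dependent). [folklore] -/
theorem det_eq_zero_of_cols_supported (M : Matrix ι ι K) (R C : Finset ι)
    (h : ∀ r c, c ∈ C → r ∉ R → M r c = 0) (hcard : R.card < C.card) : M.det = 0 := by
  classical
  -- the compressed matrix `R × C`
  let N : Matrix {r // r ∈ R} {c // c ∈ C} K := fun r c => M r c
  have hlt : Module.finrank K ({r // r ∈ R} → K) < Module.finrank K ({c // c ∈ C} → K) := by
    simpa [Module.finrank_fintype_fun_eq_card] using hcard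
  obtain ⟨x, hxker, hx0⟩ := Submodule.exists_mem_ne_zero_of_ne_bot
    (LinearMap.ker_ne_bot_of_finrank_lt (f := N.mulVecLin) hlt)
  rw [LinearMap.mem_ker, Matrix.mulVecLin_apply] at hxker
  -- extend `x` by zero
  let y : ι → K := fun i => if hi : i ∈ C then x ⟨i, hi⟩ else 0
  have hy0 : y ≠ 0 := by
    intro hy
    apply hx0
    funext c
    have := congrFun hy c
    simp only [y, dif_pos c.2, Pi.zero_apply] at this
    exact this
  have hMy : M.mulVec y = 0 := by
    funext r
    simp only [Matrix.mulVec, dotProduct, Pi.zero_apply]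
    have step : ∑ i, M r i * y i = ∑ i ∈ C, M r i * y i := by
      refine (sum_subset (subset_univ C) fun i _ hi => ?_).symm
      simp [y, dif_neg hi]
    rw [step, sum_subtype C (p := fun i => i ∈ C) (fun _ => Iff.rfl)]
    by_cases hr : r ∈ R
    · have := congrFun hxker ⟨r, hr⟩
      simp only [Matrix.mulVec, dotProduct, Pi.zero_apply] at this
      rw [← this]
      refine sum_congr rfl fun c _ => ?_
      simp [y, dif_pos c.2, N]
    · refine sum_eq_zero fun c _ => ?_
      rw [h r c c.2 hr, zero_mul]
  -- hence `M` is not injective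
  by_contra hdet
  have hunit : IsUnit M := (Matrix.isUnit_iff_isUnit_det M).2 (isUnit_iff_ne_zero.2 hdet)
  have hinj := Matrix.mulVec_injective_iff_isUnit.2 hunit
  exact hy0 (hinj (by rw [hMy, Matrix.mulVec_zero]))

/-- The same over a polynomial ring with coefficients in an infinite field (evaluate at every
point). [folklore] -/
theorem det_eq_zero_of_cols_supported_mvPolynomial [Infinite K] {σ : Type*}
    (M : Matrix ι ι (MvPolynomial σ K)) (R C : Finset ι)
    (h : ∀ r c, c ∈ C → r ∉ R → M r c = 0) (hcard : R.card < C.card) : M.det = 0 := by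
  apply MvPolynomial.funext
  intro x
  rw [map_zero, RingHom.map_det]
  exact det_eq_zero_of_cols_supported _ R C (fun r c hc hr => by
    simp [RingHom.mapMatrix_apply, h r c hc hr]) hcard

end FewRows

/-! ### Transitivity of permutations on `s`-subsets -/

section Subsets

variable {m : ℕ}

/-- The number of proper non-empty subsets of `[m]` is `2^m - 2` (`m ≥ 1`). [folklore] -/
theorem card_filter_proper_nonempty (hm : 1 ≤ m) :
    ((univ : Finset (Finset (Fin m))).filter fun I => I ≠ ∅ ∧ I ≠ univ).card = 2 ^ m - 2 := by
  classical
  have hne : (∅ : Finset (Fin m)) ≠ univ := by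
    intro h
    have := congrArg Finset.card h
    simp at this
    omega
  have : (univ : Finset (Finset (Fin m))).filter (fun I => I ≠ ∅ ∧ I ≠ univ) =
      ((univ : Finset (Finset (Fin m))).erase ∅).erase univ := by
    ext I
    simp only [mem_filter, mem_univ, true_and, mem_erase]
    tauto
  rw [this, card_erase_of_mem (mem_erase.2 ⟨hne.symm, mem_univ _⟩), card_erase_of_mem (mem_univ _),
    card_univ, Fintype.card_finset, Fintype.card_fin]
  omega

end Subsets

/-! ### The count -/

section Count

variable {K : Type*} [Field K] [Infinite K] {σ : Type*} {m : ℕ} {ι : Type*} [Fintype ι]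
  [DecidableEq ι]

/-- **Counting in a good graded pencil** (LR17 §6, end of the proof of Thm. 2.8, elementary form;
see the module docstring for the hypotheses): `2^m - 1 ≤ |ι|`. [cite: LandsbergRessayre2017, §6] -/
theorem two_pow_sub_one_le_card_of_goodGradedPencil (hm : 1 ≤ m)
    (A : Matrix ι ι (MvPolynomial σ K)) (IS IT : ι → Finset (Fin m))
    (h01 : ∀ r c, A r c ≠ 0 → IT r = IS c ∨ ∃ i, i ∉ IS c ∧ IT r = insert i (IS c))
    (hdet : A.det ≠ 0)
    (h3 : ∀ I : Finset (Fin m),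
      (univ.filter fun r => IT r = I).card + (if I = ∅ then 1 else 0) =
        (univ.filter fun c => IS c = I).card + (if I = univ then 1 else 0))
    (h4 : ∀ (e : Equiv.Perm (Fin m)) (I : Finset (Fin m)),
      (univ.filter fun c => IS c = I.map e.toEmbedding).card = (univ.filter fun c => IS c = I).card) :
    2 ^ m - 1 ≤ Fintype.card ι := by
  classical
  set nS : Finset (Fin m) → ℕ := fun I => (univ.filter fun c => IS c = I).card with hnS
  set nT : Finset (Fin m) → ℕ := fun I => (univ.filter fun r => IT r = I).card with hnT
  have huniv_ne : (univ : Finset (Fin m)) ≠ ∅ := by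
    intro h
    have := congrArg Finset.card h
    simp at this
    omega
  -- the kernel column: `nS ∅ ≥ 1`
  have hS0 : nS ∅ = nT ∅ + 1 := by
    have := h3 ∅
    rw [if_pos rfl, if_neg (Ne.symm huniv_ne)] at this
    simp only [hnS, hnT]
    omega
  -- Step 1: every level `1 ≤ s ≤ m - 1` is occupied by a column
  have level : ∀ s, 1 ≤ s → s + 1 ≤ m → ∃ c, (IS c).card = s := by
    intro s hs1 hsm
    by_contra hnone
    push Not at hnone
    -- no row at level `s` either
    have hrow : ∀ r, (IT r).card ≠ s := by
      intro r hr
      have hI1 : IT r ≠ ∅ := by intro h; rw [h, card_empty] at hr; omega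
      have hI2 : IT r ≠ univ := by intro h; rw [h, card_univ, Fintype.card_fin] at hr; omega
      have h3r := h3 (IT r)
      rw [if_neg hI1, if_neg hI2, add_zero, add_zero] at h3r
      have hpos : 0 < (univ.filter fun r' => IT r' = IT r).card :=
        card_pos.2 ⟨r, by simp⟩
      rw [h3r] at hpos
      obtain ⟨c, hc⟩ := card_pos.1 hpos
      simp only [mem_filter, mem_univ, true_and] at hc
      exact hnone c (by rw [hc]; exact hr)
    let Cl : Finset ι := univ.filter fun c => (IS c).card < s
    let Rl : Finset ι := univ.filter fun r => (IT r).card < s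
    have hsupp : ∀ r c, c ∈ Cl → r ∉ Rl → A r c = 0 := by
      intro r c hc hr
      by_contra hne
      simp only [Cl, Rl, mem_filter, mem_univ, true_and] at hc hr
      rcases h01 r c hne with h | ⟨i, hi, h⟩
      · exact hr (by rw [h]; exact hc)
      · have : (IT r).card = (IS c).card + 1 := by rw [h, card_insert_of_notMem hi]
        have hne_s := hrow r
        omega
    -- the levels `< s` as a Finset of subsets
    let t : Finset (Finset (Fin m)) := univ.filter fun I => I.card < s
    have hCl : Cl.card = ∑ I ∈ t, nS I := by
      rw [card_eq_sum_card_fiberwise (f := IS) (t := t) (fun c hc => by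
        simp only [Cl, coe_filter, Set.mem_setOf_eq] at hc
        simp only [t, coe_filter, Set.mem_setOf_eq, mem_univ, true_and]
        exact hc.2)]
      refine sum_congr rfl fun I hI => ?_
      simp only [t, mem_filter, mem_univ, true_and] at hI
      simp only [hnS, Cl, filter_filter]
      congr 1
      ext c
      simp only [mem_filter, mem_univ, true_and]
      constructor
      · rintro ⟨_, h⟩; exact h
      · intro h; exact ⟨by rw [h]; exact hI, h⟩
    have hRl : Rl.card = ∑ I ∈ t, nT I := by
      rw [card_eq_sum_card_fiberwise (f := IT) (t := t) (fun r hr => by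
        simp only [Rl, coe_filter, Set.mem_setOf_eq] at hr
        simp only [t, coe_filter, Set.mem_setOf_eq, mem_univ, true_and]
        exact hr.2)]
      refine sum_congr rfl fun I hI => ?_
      simp only [t, mem_filter, mem_univ, true_and] at hI
      simp only [hnT, Rl, filter_filter]
      congr 1
      ext r
      simp only [mem_filter, mem_univ, true_and]
      constructor
      · rintro ⟨_, h⟩; exact h
      · intro h; exact ⟨by rw [h]; exact hI, h⟩
    -- termwise comparison via (h3)
    have hterm : ∀ I ∈ t, nT I + (if I = ∅ then 1 else 0) = nS I := by
      intro I hI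
      simp only [t, mem_filter, mem_univ, true_and] at hI
      have hIu : I ≠ univ := by intro h; rw [h, card_univ, Fintype.card_fin] at hI; omega
      have := h3 I
      rw [if_neg hIu, add_zero] at this
      exact this
    have hsum : Rl.card + 1 = Cl.card := by
      rw [hCl, hRl, ← sum_congr rfl hterm, sum_add_distrib]
      congr 1
      rw [sum_ite_eq' t ∅ (fun _ => 1)]  -- ∑ I ∈ t, if I = ∅ then 1 else 0
      rw [if_pos]
      simp only [t, mem_filter, mem_univ, true_and, card_empty]
      omega
    have hcard : Rl.card < Cl.card := by omega
    exact hdet (det_eq_zero_of_cols_supported_mvPolynomial A Rl Cl hsupp hcard)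
  -- Step 2: by symmetry every proper non-empty subset is occupied
  have hall : ∀ I : Finset (Fin m), I ≠ ∅ → I ≠ univ → 1 ≤ nS I := by
    intro I hI1 hI2
    have hs1 : 1 ≤ I.card := by
      rw [Nat.one_le_iff_ne_zero]; intro h; exact hI1 (card_eq_zero.1 h)
    have hsm : I.card + 1 ≤ m := by
      have hlt : I.card < (univ : Finset (Fin m)).card :=
        card_lt_card (ssubset_univ_iff.2 hI2)
      rw [card_univ, Fintype.card_fin] at hlt
      omega
    obtain ⟨c, hc⟩ := level I.card hs1 hsm
    obtain ⟨e, he⟩ := Equiv.Perm.exists_map_finset_eq (IS c) I hc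
    rw [← he]
    simp only [hnS]
    rw [h4 e (IS c)]
    exact card_pos.2 ⟨c, by simp⟩
  -- Step 3: count
  have htot : Fintype.card ι = ∑ I : Finset (Fin m), nS I := by
    rw [← card_univ]
    exact card_eq_sum_card_fiberwise (f := IS) (t := univ) fun _ _ => by simp
  let mid : Finset (Finset (Fin m)) := univ.filter fun I => I ≠ ∅ ∧ I ≠ univ
  have hmid : mid.card = 2 ^ m - 2 := card_filter_proper_nonempty hm
  have hsplit : nS ∅ + ∑ I ∈ mid, nS I ≤ ∑ I : Finset (Fin m), nS I := by
    have hdisj : Disjoint ({∅} : Finset (Finset (Fin m))) mid := by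
      rw [disjoint_singleton_left]
      simp [mid]
    have hsub : ({∅} : Finset (Finset (Fin m))) ∪ mid ⊆ univ := subset_univ _
    calc nS ∅ + ∑ I ∈ mid, nS I = ∑ I ∈ ({∅} : Finset _) ∪ mid, nS I := by
          rw [sum_union hdisj, sum_singleton]
      _ ≤ ∑ I : Finset (Fin m), nS I := sum_le_sum_of_subset hsub
  have hmidsum : mid.card ≤ ∑ I ∈ mid, nS I := by
    have := card_nsmul_le_sum mid nS 1 fun I hI => by
      simp only [mid, mem_filter, mem_univ, true_and] at hI
      exact hall I hI.1 hI.2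
    simpa using this
  have h2m : 2 ≤ 2 ^ m := by
    calc 2 = 2 ^ 1 := by norm_num
      _ ≤ 2 ^ m := Nat.pow_le_pow_right (by norm_num) hm
  omega

end Count

end Literature.Computability.AlgebraicComplexity.LR28
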